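import Summits.BirchSwinnertonDyer.Rank1Residual.Additive.RamifiedTwistTamagawa
import Summits.BirchSwinnertonDyer.Rank1Residual.Additive.SharpenedStatements
import Literature.NumberTheory.DiophantineGeometry.TateAlgorithmTameTypesOddProofs
import Literature.NumberTheory.DiophantineGeometry.ConductorRingOfIntegersProofs
import Literature.NumberTheory.EllipticCurves.BSDConductorProofs
import HarnessLib

/-!
# The ramified quadratic twist of a `p`-semistable curve has conductor exponent `f_p = 2` (`δ_p = 0`): the census bit "tame" is a theorem on the semistable-twist rows (cell `b2b-bsdres`, seat additive-p4, line V9d)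

HONEST FRAMING (cell `b2b-bsdres`, run/shared/lean/b2b/bsd-rank1-residual/, verbatim in every
file): the goal of the cell is to DELETE the COMBINATION-SHAPED residual classes of the
Birch–Swinnerton-Dyer formula for ALL analytic-rank `≤ 1` elliptic curves over `ℚ` — "full BSD
formula for every rank `≤ 1` curve in class `C`" assembled STRICTLY from published theorems — so
that the rank-`≤ 1` remainder becomes exactly the CONSTRUCTION-SHAPED classes, which are TYPED
(missing-input `Prop`s), NOT attempted. This is not "finishing BSD". The additive sub-cell (seats
additive-p1…p4) is a RESEARCH ROUTE on the construction-shaped classes X3/X4; no claim beyond the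
stated classes; the labels of X3/X4 are UNCHANGED.

Theorems only (no definition, no named fact). A by-product of `kodairaSymbolAt_twist_of_semistable`
(`Additive/RamifiedTwistKodairaSymbol.lean`, p205165: any equation `W` of the twist `V^{(D)}` of a
globally minimal `V/ℚ`, good or multiplicative at the place `v` over an odd prime `ℓ ∥ D`, has
Kodaira type `Iₙ*` at `v`) and the tree's tame case of Ogg's formula in odd residue characteristic
(`conductorExponent_eq_two_of_kodairaSymbolAt`, `wildConductorExponent_eq_zero_of_kodairaSymbolAt`,
file `TateAlgorithmTameTypesOddProofs`, valid for `ℓ = 3`):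

* `conductorExponent_twist_of_semistable_eq_two`, `wildConductorExponent_twist_of_semistable_eq_zero`
  — `f_v(W) = 2`, `δ_v(W) = 0` at the place `v` of `𝓞 ℚ`;
* `condExpTwo_of_twist_pm_p` — the prime-indexed census form: `W ≅ V^{(±p)}`, `Good V p ∨ Mult V p`,
  `p` odd ⇒ `CondExpTwo W p` (`f_p(E) = 2`, the hyp seat's bit "tame" of `SharpenedStatements.lean`,
  computed at the place of `ℤ`; bridge `conductorExponent_ringOfIntegers_eq`). So on the
  semistable-twist rows ((M) ∪ (G-ord, e = 2)) "tame" is automatic — at `p = 3` included, where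
  wild conductors `f_3 ∈ {3,4,5}` do occur on OTHER additive rows (cell (w)).

References: [SilvermanATAEC1994] IV.9.4, IV.10.4, proof of IV.11.1 for `p = 3` (PDF pp. 366–368);
S. Comalada, J. Number Theory 49 (1994) §2 (`N(E ⊗ χ_p)` at a semistable odd `p`).
-/

noncomputable section

open scoped Classical

namespace Summit.BirchSwinnertonDyer.Rank1Residual.Additive

section Conductor

open IsDedekindDomain IsDedekindDomain.HeightOneSpectrum NumberField Rat.HeightOneSpectrum WeierstrassCurve
  Literature.NumberTheory.EllipticCurves Literature.NumberTheory.EllipticCurves.Rank1Residual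

variable (v : HeightOneSpectrum (𝓞 ℚ))

/-- The residue ring of `𝓞 ℚ` at the place `v` over the prime `ℓ` has characteristic `ℓ`
(as in eisenstein-p2's `X2.ringChar_quot_asIdeal_eq_primesEquiv`). [folklore] -/
private theorem ringChar_quot_asIdeal_eq (v : HeightOneSpectrum (𝓞 ℚ)) :
    ringChar (𝓞 ℚ ⧸ v.asIdeal) = (primesEquiv v : ℕ) := by
  have hp : (primesEquiv v : ℕ).Prime := (primesEquiv v).2
  have hmem : ((primesEquiv v : ℕ) : 𝓞 ℚ) ∈ v.asIdeal :=
    (natCast_mem_asIdeal_iff_eq_primesEquiv_symm v hp).mpr (by simp)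
  haveI : Nontrivial (𝓞 ℚ ⧸ v.asIdeal) := Ideal.Quotient.nontrivial_iff.mpr v.isPrime.ne_top
  apply CharP.ringChar_of_prime_eq_zero hp
  rw [← map_natCast (Ideal.Quotient.mk v.asIdeal), Ideal.Quotient.eq_zero_iff_mem]
  exact hmem

/-- **`f_v(W) = 2`** for any equation `W` of the twist `V^{(D)}` of a globally minimal `V/ℚ` good or
multiplicative at the place `v` over an odd prime `ℓ ∥ D`: Kodaira type `Iₙ*`
(`kodairaSymbolAt_twist_of_semistable`) and the tame case of Ogg's formula in odd residue
characteristic (`conductorExponent_eq_two_of_kodairaSymbolAt`).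
[cite: SilvermanATAEC1994, IV.10.4 and proof of IV.11.1 for p = 3 (PDF pp. 366–368)] -/
theorem conductorExponent_twist_of_semistable_eq_two (V : WeierstrassCurve ℚ) [V.IsElliptic]
    [V.IsGloballyMinimal] (hv2 : (primesEquiv v : ℕ) ≠ 2) {D : ℤ} (hD0 : D ≠ 0)
    (h1 : ((primesEquiv v : ℕ) : ℤ) ∣ D) (h2 : ¬ ((primesEquiv v : ℕ) : ℤ) ^ 2 ∣ D)
    (hV : V.HasGoodReductionAt v ∨ V.HasMultiplicativeReductionAt v)
    {W : WeierstrassCurve ℚ} [W.IsElliptic] (C : VariableChange ℚ)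
    (hW : C • V.quadraticTwist (D : ℚ) = W) : W.conductorExponent v = 2 := by
  haveI : Finite (IsLocalRing.ResidueField (v.adicCompletionIntegers ℚ)) :=
    HeightOneSpectrum.finite_residueField_adicCompletionIntegers ℚ v
  haveI : PerfectField (IsLocalRing.ResidueField (v.adicCompletionIntegers ℚ)) :=
    PerfectField.ofFinite
  have hchar : ringChar (𝓞 ℚ ⧸ v.asIdeal) ≠ 2 := by rw [ringChar_quot_asIdeal_eq v]; exact hv2
  exact W.conductorExponent_eq_two_of_kodairaSymbolAt v hchar
    (Or.inr (Or.inr (kodairaSymbolAt_twist_of_semistable v V hv2 hD0 h1 h2 hV C hW)))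

/-- **`δ_v(W) = 0`** (no wild part) in the same situation. [cite: SilvermanATAEC1994, proof of IV.11.1 for p = 3 (PDF pp. 366–368)] -/
theorem wildConductorExponent_twist_of_semistable_eq_zero (V : WeierstrassCurve ℚ) [V.IsElliptic]
    [V.IsGloballyMinimal] (hv2 : (primesEquiv v : ℕ) ≠ 2) {D : ℤ} (hD0 : D ≠ 0)
    (h1 : ((primesEquiv v : ℕ) : ℤ) ∣ D) (h2 : ¬ ((primesEquiv v : ℕ) : ℤ) ^ 2 ∣ D)
    (hV : V.HasGoodReductionAt v ∨ V.HasMultiplicativeReductionAt v)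
    {W : WeierstrassCurve ℚ} [W.IsElliptic] (C : VariableChange ℚ)
    (hW : C • V.quadraticTwist (D : ℚ) = W) : W.wildConductorExponent v = 0 := by
  haveI : Finite (IsLocalRing.ResidueField (v.adicCompletionIntegers ℚ)) :=
    HeightOneSpectrum.finite_residueField_adicCompletionIntegers ℚ v
  haveI : PerfectField (IsLocalRing.ResidueField (v.adicCompletionIntegers ℚ)) :=
    PerfectField.ofFinite
  have hchar : ringChar (𝓞 ℚ ⧸ v.asIdeal) ≠ 2 := by rw [ringChar_quot_asIdeal_eq v]; exact hv2
  exact W.wildConductorExponent_eq_zero_of_kodairaSymbolAt v hchar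
    (Or.inr (Or.inr (kodairaSymbolAt_twist_of_semistable v V hv2 hD0 h1 h2 hV C hW)))

/-- **The census bit "tame" is a theorem on the semistable-twist rows**: for `W ≅ V^{(±p)}`
globally minimal, `V` globally minimal with `Good V p ∨ Mult V p`, `p` odd: `CondExpTwo W p`
(`f_p(E) = 2` at the place of `ℤ` over `p`, `SharpenedStatements.lean`), through the `𝓞 ℚ`/`ℤ`
bridge `conductorExponent_ringOfIntegers_eq`. At `p = 3` this separates the (M) ∪ (G-ord, e = 2)
rows from the wild cell (w). [cite: SilvermanATAEC1994, IV.10.4 and proof of IV.11.1 for p = 3 (PDF pp. 366–368)] -/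
theorem condExpTwo_of_twist_pm_p (p : ℕ) [hp : Fact p.Prime] (hp2 : p ≠ 2)
    (V : WeierstrassCurve ℚ) [V.IsElliptic] [V.IsGloballyMinimal]
    (hV : Good V p ∨ Mult V p) {d : ℚ} (hd : d = p ∨ d = -p)
    {W : WeierstrassCurve ℚ} [W.IsElliptic] [W.IsGloballyMinimal] (C : VariableChange ℚ)
    (hW : C • V.quadraticTwist d = W) : CondExpTwo W p := by
  set v : HeightOneSpectrum (𝓞 ℚ) := (primesEquiv (R := 𝓞 ℚ)).symm ⟨p, hp.out⟩ with hvdef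
  have hv : (primesEquiv v : ℕ) = p := by rw [hvdef, Equiv.apply_symm_apply]
  obtain ⟨D, hDd, hD⟩ : ∃ D : ℤ, (D : ℚ) = d ∧ (D = p ∨ D = -p) := by
    rcases hd with rfl | rfl
    · exact ⟨p, by push_cast; rfl, Or.inl rfl⟩
    · exact ⟨-p, by push_cast; rfl, Or.inr rfl⟩
  have hpZ : Prime (p : ℤ) := Nat.prime_iff_prime_int.mp hp.out
  have hD0 : D ≠ 0 := by
    rcases hD with rfl | rfl <;> simp [hp.out.ne_zero]
  have h1 : ((primesEquiv v : ℕ) : ℤ) ∣ D := by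
    rw [hv]; rcases hD with rfl | rfl <;> simp
  have h2 : ¬ ((primesEquiv v : ℕ) : ℤ) ^ 2 ∣ D := by
    rw [hv]
    intro h
    have h' : (p : ℤ) * p ∣ (p : ℤ) * 1 := by
      rcases hD with rfl | rfl
      · simpa [sq] using h
      · simpa [sq] using (dvd_neg.mpr h)
    have := (mul_dvd_mul_iff_left hpZ.ne_zero).mp h'
    exact hpZ.not_unit (isUnit_of_dvd_one this)
  have hV' : V.HasGoodReductionAt v ∨ V.HasMultiplicativeReductionAt v := by
    rcases hV with hg | hm
    · exact Or.inl ((hasGoodReductionAtPrime_primesEquiv_iff_holds V v p hv).mp hg)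
    · exact Or.inr ((hasMultiplicativeReductionAtPrime_primesEquiv_iff_holds V v p hv).mp hm)
  rw [← hDd] at hW
  have hf := conductorExponent_twist_of_semistable_eq_two v V (by rw [hv]; exact hp2) hD0 h1 h2 hV' C hW
  -- transport to the place of `ℤ`
  unfold CondExpTwo condExp placeOf
  rw [← hf, conductorExponent_ringOfIntegers_eq W v]
  congr 2
  exact ((primesEquiv (R := 𝓞 ℚ)).apply_symm_apply ⟨p, hp.out⟩).symm

end Conductor

end Summit.BirchSwinnertonDyer.Rank1Residual.Additive

end
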